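import Summits.Ventures.HSemireg.PhaseTorusLawProof

/-!
# Phase-torus law on `(μ₄)⁴` at corank ≤ 7: the sharp box-covering range ⇒ `phaseTorusLaw7_holds`
# (HSemireg support file, third of three; «control» lens g5, LINE for idea-crit-6, 2026-08-29)

Sequel of `Summits/Ventures/HSemireg/PhaseTorusLaw.lean` (definitions, covering lemma, PART C) and
`Summits/Ventures/HSemireg/PhaseTorusLawProof.lean` (PARTS A·B·D ⇒ `phaseTorusLaw_holds`, the law at corank ≤ 4).
This file = PART E of the crux workfile `Cruxes/BlochSeedDiscOne/PhaseTorusLaw.lean` v4 (memo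
`Cruxes/BlochSeedDiscOne/PHASE-TORUS-LAW-g5.md` §9 (C⁷)): the box covering holds for EVERY `|A| ≤ 7` by greedy halving
(`exists_half_host`: on a host coordinate `f ≠ f₀` some adjacent pair `{s, s+1}` contains the `f`-values of at least half of
the points, because the four adjacent pairs cover each value exactly twice; three host coordinates take `7 → ≤ 3 → ≤ 1 → 0`
uncovered points: `box_cover_seven`), hence the product certificate `rot_step` of the sequel runs verbatim and gives
**`phaseTorusLaw7_holds : PhaseTorusLaw7`** — a real signed measure on `(μ₄)⁴` whose clean moments vanish and which is
non-positive outside at most SEVEN points has vanishing top moment — and `phaseTorusLaw_of_seven : PhaseTorusLaw7 → PhaseTorusLaw`.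
The first failure of the box covering is at `|A| = 8` (exact 2-cube tilings of every 3-projection, e.g. the even-weight real
set `E8`; memo §9 (E8)), so 7 is the sharp range OF THIS CERTIFICATE (not necessarily of the law).
Nothing in this file proves HC, HC_AV, HC_CM, H2 or item 18881; census-neutral (design-level meaning: an integer clean LINE
design with a two-term cokernel presentation of corank ≤ 7 carries no Weil moment — dictionary in the crux workfile
`LinePhaseTorus.lean`). Everything PROVED (axioms `propext`, `Classical.choice`, `Quot.sound`); no `sorry`, no named fact
(the one `def … : Prop`, `PhaseTorusLaw7`, is proved in-file), no instance, no notation. Statements and proofs: control g5.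
-/

namespace Summit.Ventures.HSemireg.PhaseTorus

open Finset BigOperators

/-! ## PART E — the sharp covering range (control g5, memo §9): box covering for every `|A| ≤ 7` (any prescribed free
coordinate), hence the phase-torus law at corank `≤ 7`.  Greedy halving: on one coordinate some adjacent pair `{s, s+1}`
hosts at least half of any finite set (each value lies in exactly two of the four adjacent pairs), so three coordinates
host `7 → ≤ 3 → ≤ 1 → 0`.  The first obstruction is `|A| = 8` (2-cube tilings `E8 ∕ O8`, memo §9; not typed here). -/

/-- on a fixed coordinate `f`, some adjacent pair `{s, s+1}` leaves at most half of `B` unhosted. -/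
theorem exists_half_host (B : Finset PT) (f : Fin 4) :
    ∃ s : ZMod 4, 2 * (B.filter (fun a => ¬(a f = s ∨ a f = s + 1))).card ≤ B.card := by
  by_contra hcon
  rw [not_exists] at hcon
  -- double counting: Σ_s #unhosted_s = Σ_a #{s : a f ∉ {s, s+1}} = 2·|B|
  have hcount : ∀ v : ZMod 4, (Finset.univ.filter (fun s : ZMod 4 => ¬(v = s ∨ v = s + 1))).card = 2 := by
    decide
  have hsum : ∑ s : ZMod 4, (B.filter (fun a => ¬(a f = s ∨ a f = s + 1))).card = 2 * B.card := by
    simp only [Finset.card_filter]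
    rw [Finset.sum_comm]
    simp only [← Finset.card_filter, hcount]
    simp [Finset.sum_const, mul_comm]
  have hlt : ∑ s : ZMod 4, B.card < ∑ s : ZMod 4, 2 * (B.filter (fun a => ¬(a f = s ∨ a f = s + 1))).card :=
    Finset.sum_lt_sum_of_nonempty Finset.univ_nonempty fun s _ => not_le.mp (hcon s)
  rw [← Finset.mul_sum, hsum] at hlt
  simp at hlt
  omega

/-- **box covering for `|A| ≤ 7`**, with any prescribed free coordinate `f₀`. -/
theorem box_cover_seven (A : Finset PT) (hA : A.card ≤ 7) (f₀ : Fin 4) :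
    ∃ s : Fin 4 → ZMod 4, ∀ a ∈ A, ∃ f, f ≠ f₀ ∧ (a f = s f ∨ a f = s f + 1) := by
  have h1 : f₀ + 1 ≠ f₀ := by revert f₀; decide
  have h2 : f₀ + 2 ≠ f₀ := by revert f₀; decide
  have h3 : f₀ + 3 ≠ f₀ := by revert f₀; decide
  have h12 : f₀ + 1 ≠ f₀ + 2 := by revert f₀; decide
  have h13 : f₀ + 1 ≠ f₀ + 3 := by revert f₀; decide
  have h23 : f₀ + 2 ≠ f₀ + 3 := by revert f₀; decide
  obtain ⟨s₁, hs₁⟩ := exists_half_host A (f₀ + 1)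
  set B₁ := A.filter (fun a => ¬(a (f₀ + 1) = s₁ ∨ a (f₀ + 1) = s₁ + 1)) with hB₁
  obtain ⟨s₂, hs₂⟩ := exists_half_host B₁ (f₀ + 2)
  set B₂ := B₁.filter (fun a => ¬(a (f₀ + 2) = s₂ ∨ a (f₀ + 2) = s₂ + 1)) with hB₂
  obtain ⟨s₃, hs₃⟩ := exists_half_host B₂ (f₀ + 3)
  set B₃ := B₂.filter (fun a => ¬(a (f₀ + 3) = s₃ ∨ a (f₀ + 3) = s₃ + 1)) with hB₃
  have hB₃e : B₃ = ∅ := by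
    apply Finset.card_eq_zero.mp
    omega
  refine ⟨fun f => if f = f₀ + 1 then s₁ else if f = f₀ + 2 then s₂ else s₃, fun a ha => ?_⟩
  by_cases c1 : a (f₀ + 1) = s₁ ∨ a (f₀ + 1) = s₁ + 1
  · exact ⟨f₀ + 1, h1, by simpa using c1⟩
  have ha1 : a ∈ B₁ := Finset.mem_filter.2 ⟨ha, c1⟩
  by_cases c2 : a (f₀ + 2) = s₂ ∨ a (f₀ + 2) = s₂ + 1
  · exact ⟨f₀ + 2, h2, by simpa [h12.symm] using c2⟩
  have ha2 : a ∈ B₂ := Finset.mem_filter.2 ⟨ha1, c2⟩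
  by_cases c3 : a (f₀ + 3) = s₃ ∨ a (f₀ + 3) = s₃ + 1
  · exact ⟨f₀ + 3, h3, by simpa [h13.symm, h23.symm] using c3⟩
  have ha3 : a ∈ B₃ := Finset.mem_filter.2 ⟨ha2, c3⟩
  rw [hB₃e] at ha3
  simp at ha3

/-- the phase-torus law at corank `≤ 7` (the sharp covering range; memo §9). -/
def PhaseTorusLaw7 : Prop :=
  ∀ (ω : PT → ℝ) (A : Finset PT), A.card ≤ 7 → (∀ τ, τ ∉ A → ω τ ≤ 0) →
    (∀ k, KAdm k → moment ω k = 0) → moment ω (fun _ => 1) = 0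

/-- **the phase-torus law holds at corank `≤ 7`** (same certificate as `phaseTorusLaw_holds`, box from `box_cover_seven`). -/
theorem phaseTorusLaw7_holds : PhaseTorusLaw7 := by
  intro ω A hA hω hK
  obtain ⟨s, hbox⟩ := box_cover_seven A hA 0
  set P : ℂ := ∏ f ∈ Finset.univ.erase (0 : Fin 4), (starRingEnd ℂ) (zPair (s f)) / 2 with hP
  have hPne : P ≠ 0 := Finset.prod_ne_zero_iff.2 fun f _ =>
    div_ne_zero ((map_ne_zero _).2 (zPair_ne_zero _)) (by norm_num)
  have key : ∀ w : ZMod 4, (e (-w) * (P * moment ω (fun _ => 1) / 4)).re ≤ 0 := by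
    intro w
    have h := rot_step ω A hω hK 0 s hbox w
    rw [prod_cvec_one] at h
    have hrw : e (-w) / 4 * P * moment ω (fun _ => 1) = e (-w) * (P * moment ω (fun _ => 1) / 4) := by ring
    rw [hrw] at h
    exact h
  have hz : P * moment ω (fun _ => 1) / 4 = 0 := by
    apply eq_zero_of_re_rot_nonpos
    · have := key 0; rwa [neg_zero, e_zero] at this
    · have := key 3; rwa [show (-3 : ZMod 4) = 1 from by decide, e_one] at this
    · have := key 2; rwa [show (-2 : ZMod 4) = 2 from by decide, e_two] at this
    · have := key 1; rwa [show (-1 : ZMod 4) = 3 from by decide, e_three] at this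
  have h4 : (4 : ℂ) ≠ 0 := by norm_num
  rcases mul_eq_zero.1 ((div_eq_zero_iff.1 hz).resolve_right h4) with h | h
  · exact absurd h hPne
  · exact h

/-- the corank-`≤ 4` law is a special case. -/
theorem phaseTorusLaw_of_seven (h7 : PhaseTorusLaw7) : PhaseTorusLaw :=
  fun ω A hA hω hK => h7 ω A (hA.trans (by norm_num)) hω hK

end Summit.Ventures.HSemireg.PhaseTorus
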